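import Summits.SmoothPoincare4.SmoothPoincare4.Theses.SblfDescent
import Summits.SmoothPoincare4.SmoothPoincare4.Theorems.SblfDescentStepTwoStubSblfTransport
import Literature.Topology.FourManifolds.GenusOneSblfOnSphereFour

/-!
# SmoothPoincare4 / SblfDescent — crux `StepTwo`, line `Sketch` (recognition + ADK transport): lead skeleton v3

Crux item stmt-SmoothPoincare4-18529, route decl
`Summit.SmoothPoincare4.SmoothPoincare4.Theses.SblfDescent.StepTwo`:
for every smooth `M ≃ₕ S⁴`, an SBLF of lower genus `1` (genus `2`) on `M` yields one of lower genus `0`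
(genus `1`).  The route's inline predicate `HAS(M, n)` is, field for field,
`∃ o f L, Literature.Topology.FourManifolds.IsSimplifiedBrokenLefschetzFibration o f L n`.

Line `Sketch` (cards `montesinos-torus-surgery-rigidity`, `signature-pin-cable-push`): both cards end with the
same transfer — "`M ≅ S⁴` (genus-two recognition), then `HAS(M, 0)` by transporting the
Auroux–Donaldson–Katzarkov genus-1 fibration of `S⁴`".  Skeleton v3 (continuation lead c1) = v1 with the
transport stub DISCHARGED (landed p148441, `Theorems/SblfDescentStepTwoStubSblfTransport.lean`, imported here):

* `stub_genusTwoRecognition` (APEX, SPC4-shielded, crux-equivalent modulo the published genus-one rung —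
  `Theorems/SblfDescentStepTwoReduction.lean`): a smooth homotopy 4-sphere with a genus-2 SBLF is `≅ S⁴`;
* `stub_adkGenusOneSphere` (published fact, vendored as the named Literature fact
  `exists_sblf_genus_one_noLefschetz_sphere_four`, p146689; closes by a two-line proof the day its
  `_holds` lands): the unit sphere `S⁴ ⊆ ℝ⁵` carries a genus-1 SBLF with non-empty round locus.

`StepTwo_of` is the composition: unpack `HAS(M,1)`, recognise `M ≅ S⁴`, transport ADK's fibration along the
diffeomorphism (`stub_sblfTransport`, landed), repack.  Sorry-free apart from the two stubs; concludes the
crux BY NAME.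
-/

set_option linter.dupNamespace false

namespace Summit.SmoothPoincare4.SmoothPoincare4.Theorems

open scoped Manifold ContDiff Topology ContinuousMap

/-- **Stub (line Sketch, apex): genus-two recognition on homotopy 4-spheres.**  A Hausdorff second
countable smooth 4-manifold `X ≃ₕ S⁴` carrying a simplified broken Lefschetz fibration of lower genus `1`
(genus `2`; by the Euler count necessarily with four Lefschetz points) is diffeomorphic to the unit sphere
`S⁴ ⊆ ℝ⁵`.  Informal plan (cards montesinos-torus-surgery-rigidity K1/K2/P1/P2, signature-pin-cable-push
K1/K2): the Hurwitz cycle system `(c; c₁, …, c₄)` of `f` together with its `ℤ² = π₁ Diff₀(T²)` lower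
gluing twist is equivalent to one realised on `S⁴`; either the census pins the twist (then `X ≅ S⁴` by
fibrewise diffeomorphism) or the total space is a Dehn surgery on the (unknotted, K1) lower fibre torus
of `S⁴` and Montesinos 1983 recognises `S⁴`.  SPC4-shielded: a counterexample is an exotic `S⁴` of broken
genus `2`; CRUX-EQUIVALENT: `StepTwo` + `RungOne` give it back (`genusTwoRecognition_of_stepTwo`). -/
theorem stub_genusTwoRecognition :
    ∀ (X : Type) [TopologicalSpace X] [T2Space X] [SecondCountableTopology X]
      [ChartedSpace (EuclideanSpace ℝ (Fin 4)) X] [IsManifold (𝓡 4) ((⊤ : ℕ∞) : WithTop ℕ∞) X],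
      X ≃ₕ Metric.sphere (0 : EuclideanSpace ℝ (Fin 5)) 1 →
      (∃ (o : Literature.Topology.FourManifolds.SmoothOrientation (𝓡 4) X)
          (f : X → Metric.sphere (0 : EuclideanSpace ℝ (Fin 3)) 1) (L : Finset X),
          Literature.Topology.FourManifolds.IsSimplifiedBrokenLefschetzFibration o f L 1) →
      Nonempty (Diffeomorph (𝓡 4) (𝓡 4) X (Metric.sphere (0 : EuclideanSpace ℝ (Fin 5)) 1)
        ((⊤ : ℕ∞) : WithTop ℕ∞)) := by
  sorry

/-- **Stub (line Sketch): the Auroux–Donaldson–Katzarkov genus-one fibration of `S⁴`.**  The unit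
sphere `S⁴ ⊆ ℝ⁵` carries a simplified broken Lefschetz fibration of lower genus `0` (genus `1`, one round
circle; ADK's example has no Lefschetz point) — Auroux–Donaldson–Katzarkov 2005, §8.2 Example 1; Hayano
2011, Rem. 4.3; Baykur–Kamada 2015, Lemma 11.  Published; vendored as the named Literature fact
`Literature.Topology.FourManifolds.exists_sblf_genus_one_noLefschetz_sphere_four` (p146689), from which
this signature follows with `L = ∅` (`stub_adkGenusOneSphere_of_fact` in the Reduction file). -/
theorem stub_adkGenusOneSphere :
    ∃ (o : Literature.Topology.FourManifolds.SmoothOrientation (𝓡 4)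
        (Metric.sphere (0 : EuclideanSpace ℝ (Fin 5)) 1))
      (f : Metric.sphere (0 : EuclideanSpace ℝ (Fin 5)) 1 →
        Metric.sphere (0 : EuclideanSpace ℝ (Fin 3)) 1)
      (L : Finset (Metric.sphere (0 : EuclideanSpace ℝ (Fin 5)) 1)),
      Literature.Topology.FourManifolds.IsSimplifiedBrokenLefschetzFibration o f L 0 := by
  sorry

/-- **Composition (line Sketch): `StepTwo` from recognition, (landed) transport and ADK.**  Unpack the
route's inline `HAS(M, 1)` into `IsSimplifiedBrokenLefschetzFibration o f L 1` (the clauses are the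
fields, in order), recognise `M ≅ S⁴` (`stub_genusTwoRecognition`), transport ADK's genus-1 fibration of
`S⁴` (`stub_adkGenusOneSphere`) back to `M` along the diffeomorphism (`stub_sblfTransport`, landed in
`Theorems/SblfDescentStepTwoStubSblfTransport.lean`), and repack into the route's inline `HAS(M, 0)`.
Sorry-free apart from the two stubs; concludes the crux BY NAME. -/
theorem StepTwo_of : Summit.SmoothPoincare4.SmoothPoincare4.Theses.SblfDescent.StepTwo := by
  intro M _ _ _ _ _ e hM
  obtain ⟨o, f, L, h1, h2, h3, h4, h5, h6, h7, h8, h9, h10⟩ := hM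
  have hS : Literature.Topology.FourManifolds.IsSimplifiedBrokenLefschetzFibration o f L 1 :=
    ⟨h1, h2, h3, h4, h5, h6, h7, h8, h9, h10⟩
  obtain ⟨Φ⟩ := stub_genusTwoRecognition M e ⟨o, f, L, hS⟩
  have key : ∃ (o' : Literature.Topology.FourManifolds.SmoothOrientation (𝓡 4) M)
      (f' : M → Metric.sphere (0 : EuclideanSpace ℝ (Fin 3)) 1) (L' : Finset M),
      Literature.Topology.FourManifolds.IsSimplifiedBrokenLefschetzFibration o' f' L' 0 :=
    stub_sblfTransport M (Metric.sphere (0 : EuclideanSpace ℝ (Fin 5)) 1) 0 ⟨Φ⟩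
      stub_adkGenusOneSphere
  obtain ⟨o', f', L', g1, g2, g3, g4, g5, g6, g7, g8, g9, g10⟩ := key
  exact ⟨o', f', L', g1, g2, g3, g4, g5, g6, g7, g8, g9, g10⟩

end Summit.SmoothPoincare4.SmoothPoincare4.Theorems
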